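import Summits.Ventures.LatticeQCDFlow.Exactness.RefreshScan
import HarnessLib

/-!
# The heat-bath sweep is exact and uniformly ergodic: a scan of single-site heat baths with a bounded joint density satisfies Doeblin

HONEST FRAMING: exact (Metropolis-corrected) sampling algorithms for lattice gauge theory;
figures of merit are autocorrelation/cost numbers at stated couplings and volumes; no
continuum-physics claim.

Venture `LatticeQCDFlow` (cell pub-lqcd), topic `Exactness`, FANOUT row 9 (eng-latcore, the
engine `latflow.core`).  NEW WORK of the cell over Mathlib's Markov-kernel library and
`MeasureTheory.lmarginal`, composed with `Exactness/RefreshScan.lean` (minorisation algebra, the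
forgetful refresh scan, the Doeblin bridge `uniformlyErgodic_of_minorised` to
`Literature.Probability.MarkovChains.Doeblin.doeblin_iterate_sub_invariant_le`) and
`Exactness/InvariantComposition.lean` (update cycles are exact).  Nothing here is cited as a fact.
Printed counterparts, NAMED ONLY: Geman–Geman 1984 / Gelfand–Smith 1990 (the Gibbs sampler leaves
the joint law invariant); Roberts–Polson 1994 (J. R. Stat. Soc. B 56: a Gibbs sampler whose joint
density is bounded away from `0` and `∞` on a compact support is uniformly ergodic); Tierney 1994
§3; Meyn–Tweedie 1993 Thm 16.0.2 / 16.2.4.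

`Exactness/FibreLift.lean` (row 9) typed the heat bath on `X × Y` (one coordinate against "the
rest") and left ERGODICITY and SWEEPS "not here"; `Exactness/FreeFieldHeatBathExact.lean` (row 2)
left "convergence / uniqueness of the invariant law" NOT CLAIMED.  This file types both for the
systematic scan on a finite product `Ω = Π_{i ∈ ι} X_i` of probability spaces `(X_i, μ_i)` — the
engine's configuration space `G^{links}` with product Haar measure — and a joint density
`p : Ω → [0, ∞]` (target `π ∝ p · ⊗μ_i`).

## What is proved

* §3 (the heat bath).  `siteNorm μ p i = ∫⋯∫⁻_{i}, p ∂μ` (the conditional normaliser `Z_i`,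
  constant along the fibre), `siteHeatBath μ p i` = redraw `ω_i` with density
  `p(ω|ω_i := ξ)/Z_i(ω)` against `μ_i` (`siteLift` of `siteHeatBathLaw`);
  `lintegral_siteHeatBath` / `siteHeatBath_apply`: `∫ g dK_i(ω, ·) = (∫⋯∫⁻_{i} g·p)(ω)/Z_i(ω)`; it
  is Markov (`isMarkovKernel_siteHeatBath`) and does not read the coordinate it overwrites
  (`siteHeatBath_update`); **`siteHeatBath_isReversible`** / `siteHeatBath_invariant`: reversible
  for, hence leaving invariant, `p · ⊗μ_i` — for every measurable `p < ∞` with `0 < Z_i < ∞`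
  (the one-site flow `A → B` is `(∫⋯∫⁻_{i} 1_A p)(∫⋯∫⁻_{i} 1_B p)/Z_i`, symmetric;
  `lmarginal_flow_siteHeatBath`); `heatBathSweep_invariant`: so does every scan
  `cycle (l.map (siteHeatBath μ p))`, any list of sites.
* §4 (bounded density `m ≤ p ≤ M`, `0 < m`, `M < ∞`).  `le_siteNorm` / `siteNorm_le`
  (`m ≤ Z_i ≤ M`); `siteHeatBath_ge_refresh`: each site heat bath dominates `(m/M) ×` the free
  refresh of its site; hence (**`heatBathSweep_minorised`**) a scan over any list `l` containing
  every site satisfies DOEBLIN from every configuration, `K(ω, ·) ≥ (m/M)^{|l|} ⊗μ_i`;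
  `piGibbsLaw μ p = (∫p d⊗μ)⁻¹ p · ⊗μ_i` is an invariant probability law
  (`isProbabilityMeasure_piGibbsLaw`, `heatBathSweep_invariant_piGibbsLaw`);
  **`heatBathSweep_uniformlyErgodic`**: for every initial law `μ₀`, every `t`, every set `A`,
  `|μ₀Kᵗ(A) − piGibbsLaw(A)| ≤ (1 − (m/M)^{|l|})ᵗ`; and **`heatBathSweep_comp_uniformlyErgodic`**:
  the same bound for `η ∘ₖ K` with ANY Markov `η` leaving `p · ⊗μ_i` invariant — the engine's
  composite sweep "1 heat-bath sweep + n over-relaxation sweeps" (`updates.composite_sweep`,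
  `sun_2d.composite_sweep`, `u1_2d`), the over-relaxation sweeps being exact
  (`Exactness/WilsonOverrelaxation.lean`) but not ergodic on their own.  In particular the
  invariant probability law of such a sweep is UNIQUE (two invariant laws are both limits).

For the engine: `X_i = SU(2)` or `U(1)` per link with Haar probability, `p = e^{−S_W}` with the
Wilson action at coupling `β` on a finite lattice, so `m/M = e^{−(sup S_W − inf S_W)} > 0` and the
U(1)/SU(2) heat-bath (+ over-relaxation) stream converges to the Wilson law from every start,
setwise, geometrically.  The rate `(m/M)^{|links|}` is a qualitative certificate (ergodicity,
uniqueness of the invariant law), not a useful autocorrelation bound — those are MEASURED (A11,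
the scorers).

NOT CLAIMED: the SU(N ≥ 3) path (Cabibbo–Marinari subgroup hits are exact —
`CabibboMarinariKernel.lean` — but one hit does not dominate a Haar refresh of the link, so this
one-sweep Doeblin argument does not apply as such); HMC; unbounded fields (φ⁴: no uniform `m, M`,
see row 2's `Phi4FlowSamplerErgodic.lean` for the flow sampler instead); any floating-point or
pseudo-randomness statement; any quantitative mixing time.
-/

namespace Summit.Ventures.LatticeQCDFlow.Exactness

open MeasureTheory ProbabilityTheory Function
open scoped ENNReal

/-! ## §3 The single-site heat bath on the product space: exact -/

section HeatBath

variable {ι : Type*} [DecidableEq ι] {X : ι → Type*} [∀ i, MeasurableSpace (X i)]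
variable (μ : Π i, Measure (X i)) [∀ i, IsProbabilityMeasure (μ i)] (p : (Π j, X j) → ℝ≥0∞)

/-- The conditional normaliser of site `i`: `Z_i(ω) = ∫ p(ω|ω_i := ξ) μ_i(dξ)` (constant in `ω_i`). -/
noncomputable def siteNorm (i : ι) : (Π j, X j) → ℝ≥0∞ := ∫⋯∫⁻_{i}, p ∂μ

/-- The conditional law of site `i` given the rest: density `p(ω|ω_i := ξ) / Z_i(ω)` against `μ_i`. -/
noncomputable def siteHeatBathLaw (i : ι) : Kernel (Π j, X j) (X i) :=
  Kernel.withDensity (Kernel.const _ (μ i)) (fun ω ξ => p (update ω i ξ) * (siteNorm μ p i ω)⁻¹)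

/-- **The single-site heat bath** (Gibbs sampler step) at site `i`: redraw `ω_i` from its
conditional law given all other coordinates, whatever its current value. -/
noncomputable def siteHeatBath (i : ι) : Kernel (Π j, X j) (Π j, X j) :=
  siteLift i (siteHeatBathLaw μ p i)

variable {μ p}

omit [∀ i, IsProbabilityMeasure (μ i)] in
/-- `Z_i(ω) = ∫ p(ω|ω_i := ξ) μ_i(dξ)`. -/
theorem siteNorm_eq (i : ι) (ω : Π j, X j) :
    siteNorm μ p i ω = ∫⁻ ξ, p (update ω i ξ) ∂μ i := by
  rw [siteNorm, lmarginal_singleton]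

omit [∀ i, IsProbabilityMeasure (μ i)] in
/-- `Z_i` is constant along the fibre of site `i`. -/
theorem siteNorm_update (i : ι) (ω : Π j, X j) (ξ : X i) :
    siteNorm μ p i (update ω i ξ) = siteNorm μ p i ω :=
  lmarginal_update_of_mem μ (Finset.mem_singleton_self i) p ω ξ

/-- Measurability of `Z_i`. -/
theorem measurable_siteNorm (hp : Measurable p) (i : ι) : Measurable (siteNorm μ p i) :=
  hp.lmarginal μ

/-- Measurability of the heat-bath density `(ω, ξ) ↦ p(ω|ω_i := ξ) / Z_i(ω)`. -/
theorem measurable_siteHeatBathDensity (hp : Measurable p) (i : ι) :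
    Measurable (uncurry fun (ω : Π j, X j) (ξ : X i) => p (update ω i ξ) * (siteNorm μ p i ω)⁻¹) :=
  (hp.comp measurable_update').mul ((measurable_siteNorm hp i).comp measurable_fst).inv

/-- The conditional law is an s-finite kernel when `p < ∞` and `Z_i ≠ 0`. -/
theorem isSFiniteKernel_siteHeatBathLaw (hp_top : ∀ ω, p ω ≠ ∞) {i : ι}
    (hZ : ∀ ω, siteNorm μ p i ω ≠ 0) : IsSFiniteKernel (siteHeatBathLaw μ p i) :=
  Kernel.IsSFiniteKernel.withDensity _
    (fun ω _ => ENNReal.mul_ne_top (hp_top _) (ENNReal.inv_ne_top.mpr (hZ ω)))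

/-- **Integrating against the site heat bath**: `∫ g dK_i(ω, ·) = (∫⋯∫⁻_{i} g·p)(ω) / Z_i(ω)`. -/
theorem lintegral_siteHeatBath (hp : Measurable p) (hp_top : ∀ ω, p ω ≠ ∞) {i : ι}
    (hZ : ∀ ω, siteNorm μ p i ω ≠ 0) (ω : Π j, X j) {g : (Π j, X j) → ℝ≥0∞} (hg : Measurable g) :
    ∫⁻ ω', g ω' ∂(siteHeatBath μ p i ω) = (∫⋯∫⁻_{i}, g * p ∂μ) ω * (siteNorm μ p i ω)⁻¹ := by
  haveI := isSFiniteKernel_siteHeatBathLaw hp_top hZ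
  have hg' : Measurable fun ξ => g (update ω i ξ) := hg.comp (measurable_update ω)
  rw [siteHeatBath, lintegral_siteLift _ _ _ hg, siteHeatBathLaw,
    Kernel.lintegral_withDensity _ (measurable_siteHeatBathDensity hp i) _ hg', Kernel.const_apply,
    lmarginal_singleton]
  have hrw : ∀ ξ, p (update ω i ξ) * (siteNorm μ p i ω)⁻¹ * g (update ω i ξ) =
      (g * p) (update ω i ξ) * (siteNorm μ p i ω)⁻¹ := fun ξ => by
    rw [Pi.mul_apply]; ring
  simp_rw [hrw]
  exact lintegral_mul_const _ ((hg.mul hp).comp (measurable_update ω))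

/-- Setwise form: `K_i(ω, s) = (∫⋯∫⁻_{i} 1_s·p)(ω) / Z_i(ω)`. -/
theorem siteHeatBath_apply (hp : Measurable p) (hp_top : ∀ ω, p ω ≠ ∞) {i : ι}
    (hZ : ∀ ω, siteNorm μ p i ω ≠ 0) (ω : Π j, X j) {s : Set (Π j, X j)} (hs : MeasurableSet s) :
    siteHeatBath μ p i ω s = (∫⋯∫⁻_{i}, s.indicator 1 * p ∂μ) ω * (siteNorm μ p i ω)⁻¹ := by
  rw [← lintegral_indicator_one hs, lintegral_siteHeatBath hp hp_top hZ ω (measurable_one.indicator hs)]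

/-- The site heat bath is a Markov kernel when `p < ∞` and `0 < Z_i < ∞`. -/
theorem isMarkovKernel_siteHeatBath (hp : Measurable p) (hp_top : ∀ ω, p ω ≠ ∞) {i : ι}
    (hZ : ∀ ω, siteNorm μ p i ω ≠ 0) (hZtop : ∀ ω, siteNorm μ p i ω ≠ ∞) :
    IsMarkovKernel (siteHeatBath μ p i) := by
  refine ⟨fun ω => ⟨?_⟩⟩
  rw [← lintegral_indicator_one MeasurableSet.univ,
    lintegral_siteHeatBath hp hp_top hZ ω (measurable_one.indicator MeasurableSet.univ),
    Set.indicator_univ, one_mul]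
  exact ENNReal.mul_inv_cancel (hZ ω) (hZtop ω)

/-- The site heat bath does not read the coordinate it overwrites. -/
theorem siteHeatBath_update (hp : Measurable p) (hp_top : ∀ ω, p ω ≠ ∞) {i : ι}
    (hZ : ∀ ω, siteNorm μ p i ω ≠ 0) (ω : Π j, X j) (ξ : X i) :
    siteHeatBath μ p i (update ω i ξ) = siteHeatBath μ p i ω := by
  ext s hs
  rw [siteHeatBath_apply hp hp_top hZ _ hs, siteHeatBath_apply hp hp_top hZ _ hs, siteNorm_update,
    lmarginal_update_of_mem μ (Finset.mem_singleton_self i)]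

/-- The one-site flow `A → B` of the heat bath against `p · ⊗μ`, after integrating out site `i`:
`(∫⋯∫⁻_{i} 1_A p)(∫⋯∫⁻_{i} 1_B p)/Z_i` — symmetric in `A`, `B`. -/
theorem lmarginal_flow_siteHeatBath (hp : Measurable p) (hp_top : ∀ ω, p ω ≠ ∞) {i : ι}
    (hZ : ∀ ω, siteNorm μ p i ω ≠ 0) {A B : Set (Π j, X j)} (hA : MeasurableSet A)
    (hB : MeasurableSet B) (x : Π j, X j) :
    (∫⋯∫⁻_{i}, A.indicator (fun ω => p ω * siteHeatBath μ p i ω B) ∂μ) x =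
      (∫⋯∫⁻_{i}, A.indicator 1 * p ∂μ) x *
        ((∫⋯∫⁻_{i}, B.indicator 1 * p ∂μ) x * (siteNorm μ p i x)⁻¹) := by
  rw [lmarginal_singleton, lmarginal_singleton]
  have hrw : ∀ ξ, A.indicator (fun ω => p ω * siteHeatBath μ p i ω B) (update x i ξ) =
      (A.indicator 1 * p : (Π j, X j) → ℝ≥0∞) (update x i ξ) *
        ((∫⋯∫⁻_{i}, B.indicator 1 * p ∂μ) x * (siteNorm μ p i x)⁻¹) := fun ξ => by
    rw [Pi.mul_apply, ← siteHeatBath_apply hp hp_top hZ x hB, ← siteHeatBath_update hp hp_top hZ x ξ]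
    by_cases hξ : update x i ξ ∈ A
    · rw [Set.indicator_of_mem hξ, Set.indicator_of_mem hξ, Pi.one_apply, one_mul]
    · rw [Set.indicator_of_notMem hξ, Set.indicator_of_notMem hξ, zero_mul, zero_mul]
  simp_rw [hrw]
  exact lintegral_mul_const _ (((measurable_one.indicator hA).mul hp).comp (measurable_update x))

variable [Fintype ι]

/-- **The single-site heat bath is exact**: reversible with respect to `p · ⊗μ_i`, for every
measurable joint density `p < ∞` with non-vanishing conditional normalisers. -/
theorem siteHeatBath_isReversible (hp : Measurable p) (hp_top : ∀ ω, p ω ≠ ∞) {i : ι}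
    (hZ : ∀ ω, siteNorm μ p i ω ≠ 0) :
    Kernel.IsReversible (siteHeatBath μ p i) ((Measure.pi μ).withDensity p) := by
  intro A B hA hB
  have key : ∀ {A B : Set (Π j, X j)}, MeasurableSet A → MeasurableSet B →
      ∫⁻ ω in A, siteHeatBath μ p i ω B ∂(Measure.pi μ).withDensity p =
        ∫⁻ x, (∫⋯∫⁻_{i}, A.indicator 1 * p ∂μ) x *
          ((∫⋯∫⁻_{i}, B.indicator 1 * p ∂μ) x * (siteNorm μ p i x)⁻¹) ∂Measure.pi μ := by
    intro A B hA hB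
    have hK : Measurable fun ω => siteHeatBath μ p i ω B := Kernel.measurable_coe _ hB
    rw [setLIntegral_withDensity_eq_setLIntegral_mul _ hp hK hA, ← lintegral_indicator hA,
      ← lintegral_pi_lmarginal i ((hp.mul hK).indicator hA)]
    refine lintegral_congr fun x => ?_
    exact lmarginal_flow_siteHeatBath hp hp_top hZ hA hB x
  rw [key hA hB, key hB hA]
  refine lintegral_congr fun x => ?_
  ring

/-- … hence `p · ⊗μ_i` is invariant under the site heat bath (`0 < Z_i < ∞`). -/
theorem siteHeatBath_invariant (hp : Measurable p) (hp_top : ∀ ω, p ω ≠ ∞) {i : ι}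
    (hZ : ∀ ω, siteNorm μ p i ω ≠ 0) (hZtop : ∀ ω, siteNorm μ p i ω ≠ ∞) :
    Kernel.Invariant (siteHeatBath μ p i) ((Measure.pi μ).withDensity p) := by
  haveI := isMarkovKernel_siteHeatBath hp hp_top hZ hZtop
  exact (siteHeatBath_isReversible hp hp_top hZ).invariant

/-- **Heat-bath scans are exact**: a cycle of site heat baths over any list of sites leaves
`p · ⊗μ_i` invariant. -/
theorem heatBathSweep_invariant (hp : Measurable p) (hp_top : ∀ ω, p ω ≠ ∞)
    (hZ : ∀ i ω, siteNorm μ p i ω ≠ 0) (hZtop : ∀ i ω, siteNorm μ p i ω ≠ ∞) (l : List ι) :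
    Kernel.Invariant (cycle (l.map (siteHeatBath μ p))) ((Measure.pi μ).withDensity p) := by
  refine invariant_cycle fun κ hκ => ?_
  obtain ⟨i, -, rfl⟩ := List.mem_map.1 hκ
  exact siteHeatBath_invariant hp hp_top (hZ i) (hZtop i)

end HeatBath

/-! ## §4 Bounded joint density: Doeblin for the sweep, uniform ergodicity -/

section Bounded

variable {ι : Type*} [Fintype ι] {X : ι → Type*} [∀ i, MeasurableSpace (X i)]
variable {μ : Π i, Measure (X i)} [∀ i, IsProbabilityMeasure (μ i)] {p : (Π j, X j) → ℝ≥0∞}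
variable {m M : ℝ≥0∞}

variable (μ p) in
/-- The normalised Gibbs law `(∫ p d⊗μ)⁻¹ · p · ⊗μ_i`. -/
noncomputable def piGibbsLaw : Measure (Π j, X j) :=
  (∫⁻ ω, p ω ∂Measure.pi μ)⁻¹ • (Measure.pi μ).withDensity p

/-- Under `0 < m ≤ p ≤ M < ∞` the Gibbs law is a probability measure. -/
theorem isProbabilityMeasure_piGibbsLaw (hm0 : m ≠ 0) (hMtop : M ≠ ∞)
    (hmp : ∀ ω, m ≤ p ω) (hpM : ∀ ω, p ω ≤ M) : IsProbabilityMeasure (piGibbsLaw μ p) := by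
  haveI : ∀ i, Nonempty (X i) := fun i => nonempty_of_isProbabilityMeasure (μ i)
  have hlow : m ≤ ∫⁻ ω, p ω ∂Measure.pi μ := by
    calc m = ∫⁻ _, m ∂Measure.pi μ := by rw [lintegral_const, measure_univ, mul_one]
      _ ≤ _ := lintegral_mono fun ω => hmp ω
  have hup : ∫⁻ ω, p ω ∂Measure.pi μ ≤ M := by
    calc ∫⁻ ω, p ω ∂Measure.pi μ ≤ ∫⁻ _, M ∂Measure.pi μ := lintegral_mono fun ω => hpM ω
      _ = M := by rw [lintegral_const, measure_univ, mul_one]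
  have h0 : ∫⁻ ω, p ω ∂Measure.pi μ ≠ 0 := (lt_of_lt_of_le (pos_iff_ne_zero.2 hm0) hlow).ne'
  have htop : ∫⁻ ω, p ω ∂Measure.pi μ ≠ ∞ := ne_top_of_le_ne_top hMtop hup
  refine ⟨?_⟩
  rw [piGibbsLaw, Measure.smul_apply, smul_eq_mul, withDensity_apply _ MeasurableSet.univ,
    Measure.restrict_univ, ENNReal.inv_mul_cancel h0 htop]

variable [DecidableEq ι]

omit [Fintype ι] in
/-- Under `m ≤ p`, every conditional normaliser is at least `m`. -/
theorem le_siteNorm (hmp : ∀ ω, m ≤ p ω) (i : ι) (ω : Π j, X j) : m ≤ siteNorm μ p i ω := by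
  rw [siteNorm_eq]
  calc m = ∫⁻ _, m ∂μ i := by rw [lintegral_const, measure_univ, mul_one]
    _ ≤ ∫⁻ ξ, p (update ω i ξ) ∂μ i := lintegral_mono fun ξ => hmp _

omit [Fintype ι] in
/-- Under `p ≤ M`, every conditional normaliser is at most `M`. -/
theorem siteNorm_le (hpM : ∀ ω, p ω ≤ M) (i : ι) (ω : Π j, X j) : siteNorm μ p i ω ≤ M := by
  rw [siteNorm_eq]
  calc ∫⁻ ξ, p (update ω i ξ) ∂μ i ≤ ∫⁻ _, M ∂μ i := lintegral_mono fun ξ => hpM _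
    _ = M := by rw [lintegral_const, measure_univ, mul_one]

omit [Fintype ι] in
/-- **Each site heat bath dominates `(m/M) ×` the free refresh of its site.** -/
theorem siteHeatBath_ge_refresh (hp : Measurable p) (hm0 : m ≠ 0) (hMtop : M ≠ ∞)
    (hmp : ∀ ω, m ≤ p ω) (hpM : ∀ ω, p ω ≤ M) (i : ι) (ω : Π j, X j) :
    (m * M⁻¹) • refresh μ i ω ≤ siteHeatBath μ p i ω := by
  have hp_top : ∀ ω, p ω ≠ ∞ := fun ω => ne_top_of_le_ne_top hMtop (hpM ω)
  have hZ : ∀ ω, siteNorm μ p i ω ≠ 0 := fun ω =>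
    (lt_of_lt_of_le (pos_iff_ne_zero.2 hm0) (le_siteNorm hmp i ω)).ne'
  refine Measure.le_iff.2 fun s hs => ?_
  rw [Measure.smul_apply, smul_eq_mul, siteHeatBath_apply hp hp_top hZ ω hs,
    ← lintegral_indicator_one hs, lintegral_refresh i ω (measurable_one.indicator hs)]
  have h1 : m * (∫⋯∫⁻_{i}, s.indicator 1 ∂μ) ω ≤ (∫⋯∫⁻_{i}, s.indicator 1 * p ∂μ) ω := by
    rw [lmarginal_singleton, lmarginal_singleton]
    change m * ∫⁻ ξ, s.indicator 1 (update ω i ξ) ∂μ i ≤ _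
    have hf : Measurable fun ξ => s.indicator (1 : (Π j, X j) → ℝ≥0∞) (update ω i ξ) :=
      (measurable_one.indicator hs).comp (measurable_update ω)
    rw [← lintegral_const_mul _ hf]
    refine lintegral_mono fun ξ => ?_
    rw [Pi.mul_apply, mul_comm]
    exact mul_le_mul' le_rfl (hmp _)
  have h2 : M⁻¹ ≤ (siteNorm μ p i ω)⁻¹ := ENNReal.inv_le_inv.2 (siteNorm_le hpM i ω)
  calc m * M⁻¹ * (∫⋯∫⁻_{i}, s.indicator 1 ∂μ) ω = m * (∫⋯∫⁻_{i}, s.indicator 1 ∂μ) ω * M⁻¹ := by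
        ring
    _ ≤ (∫⋯∫⁻_{i}, s.indicator 1 * p ∂μ) ω * (siteNorm μ p i ω)⁻¹ := mul_le_mul' h1 h2

/-- **Doeblin for the heat-bath sweep**: a scan of site heat baths over a list `l` containing every
site dominates `(m/M)^{|l|} ×` the product law, from EVERY configuration. -/
theorem heatBathSweep_minorised (hp : Measurable p) (hm0 : m ≠ 0) (hMtop : M ≠ ∞)
    (hmp : ∀ ω, m ≤ p ω) (hpM : ∀ ω, p ω ≤ M) {l : List ι} (hl : ∀ i, i ∈ l) (ω : Π j, X j) :
    (m * M⁻¹) ^ l.length • Measure.pi μ ≤ cycle (l.map (siteHeatBath μ p)) ω := by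
  have h2 : List.Forall₂ (fun κ Φ => ∀ a, (m * M⁻¹) • Φ a ≤ κ a)
      (l.map (siteHeatBath μ p)) (l.map (refresh μ)) :=
    List.forall₂_map_left_iff.2 (List.forall₂_map_right_iff.2
      (List.forall₂_same.2 fun i _ a => siteHeatBath_ge_refresh hp hm0 hMtop hmp hpM i a))
  have h := cycle_minorised h2 ω
  rwa [List.length_map, cycle_refresh_eq_const hl, Kernel.const_apply] at h

/-- The Gibbs law is invariant under every heat-bath scan (bounded density). -/
theorem heatBathSweep_invariant_piGibbsLaw (hp : Measurable p) (hm0 : m ≠ 0) (hMtop : M ≠ ∞)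
    (hmp : ∀ ω, m ≤ p ω) (hpM : ∀ ω, p ω ≤ M) (l : List ι) :
    Kernel.Invariant (cycle (l.map (siteHeatBath μ p))) (piGibbsLaw μ p) := by
  have hp_top : ∀ ω, p ω ≠ ∞ := fun ω => ne_top_of_le_ne_top hMtop (hpM ω)
  have hZ : ∀ i ω, siteNorm μ p i ω ≠ 0 := fun i ω =>
    (lt_of_lt_of_le (pos_iff_ne_zero.2 hm0) (le_siteNorm hmp i ω)).ne'
  have hZtop : ∀ i ω, siteNorm μ p i ω ≠ ∞ := fun i ω =>
    ne_top_of_le_ne_top hMtop (siteNorm_le hpM i ω)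
  exact invariant_smul (heatBathSweep_invariant hp hp_top hZ hZtop l) _

omit [Fintype ι] in
/-- Every heat-bath scan is a Markov kernel (bounded density). -/
theorem isMarkovKernel_heatBathSweep (hp : Measurable p) (hm0 : m ≠ 0) (hMtop : M ≠ ∞)
    (hmp : ∀ ω, m ≤ p ω) (hpM : ∀ ω, p ω ≤ M) (l : List ι) :
    IsMarkovKernel (cycle (l.map (siteHeatBath μ p))) := by
  have hp_top : ∀ ω, p ω ≠ ∞ := fun ω => ne_top_of_le_ne_top hMtop (hpM ω)
  refine isMarkovKernel_cycle fun κ hκ => ?_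
  obtain ⟨i, -, rfl⟩ := List.mem_map.1 hκ
  exact isMarkovKernel_siteHeatBath hp hp_top
    (fun ω => (lt_of_lt_of_le (pos_iff_ne_zero.2 hm0) (le_siteNorm hmp i ω)).ne')
    (fun ω => ne_top_of_le_ne_top hMtop (siteNorm_le hpM i ω))

/-- **The heat-bath sweep is uniformly ergodic.**  On a finite product of probability spaces with
a measurable joint density `m ≤ p ≤ M` (`0 < m`, `M < ∞`), a scan of single-site heat baths over
any list `l` of sites containing every site converges to the Gibbs law from EVERY initial law,
setwise and geometrically: `|μ₀Kᵗ(A) − π(A)| ≤ (1 − (m/M)^{|l|})ᵗ`. -/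
theorem heatBathSweep_uniformlyErgodic (hp : Measurable p) (hm0 : m ≠ 0) (hMtop : M ≠ ∞)
    (hmp : ∀ ω, m ≤ p ω) (hpM : ∀ ω, p ω ≤ M) {l : List ι} (hl : ∀ i, i ∈ l)
    (μ₀ : Measure (Π j, X j)) [IsProbabilityMeasure μ₀] (t : ℕ) (A : Set (Π j, X j)) :
    |((fun ν : Measure (Π j, X j) => ν.bind (cycle (l.map (siteHeatBath μ p))))^[t] μ₀).real A
        - (piGibbsLaw μ p).real A| ≤ (1 - (m.toReal / M.toReal) ^ l.length) ^ t := by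
  haveI := isMarkovKernel_heatBathSweep (μ := μ) hp hm0 hMtop hmp hpM l
  haveI := isProbabilityMeasure_piGibbsLaw (μ := μ) (p := p) hm0 hMtop hmp hpM
  have h := uniformlyErgodic_of_minorised (heatBathSweep_minorised (μ := μ) hp hm0 hMtop hmp hpM hl)
    (heatBathSweep_invariant_piGibbsLaw (μ := μ) hp hm0 hMtop hmp hpM l) μ₀ t A
  rwa [ENNReal.toReal_pow, ENNReal.toReal_mul, ENNReal.toReal_inv, ← div_eq_mul_inv] at h

/-- **… and so is the engine's composite sweep** "heat-bath sweep, then any exact update": for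
every Markov kernel `η` leaving `p · ⊗μ_i` invariant (over-relaxation sweeps, measure-preserving
reflections, further exact hits), `η ∘ₖ K` obeys the same bound
`|μ₀(ηK)ᵗ(A) − π(A)| ≤ (1 − (m/M)^{|l|})ᵗ`; in particular its invariant probability law is unique. -/
theorem heatBathSweep_comp_uniformlyErgodic (hp : Measurable p) (hm0 : m ≠ 0) (hMtop : M ≠ ∞)
    (hmp : ∀ ω, m ≤ p ω) (hpM : ∀ ω, p ω ≤ M) {l : List ι} (hl : ∀ i, i ∈ l)
    (η : Kernel (Π j, X j) (Π j, X j)) [IsMarkovKernel η]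
    (hη : Kernel.Invariant η ((Measure.pi μ).withDensity p))
    (μ₀ : Measure (Π j, X j)) [IsProbabilityMeasure μ₀] (t : ℕ) (A : Set (Π j, X j)) :
    |((fun ν : Measure (Π j, X j) =>
        ν.bind (η ∘ₖ cycle (l.map (siteHeatBath μ p))))^[t] μ₀).real A
        - (piGibbsLaw μ p).real A| ≤ (1 - (m.toReal / M.toReal) ^ l.length) ^ t := by
  haveI : ∀ i, Nonempty (X i) := fun i => nonempty_of_isProbabilityMeasure (μ i)
  haveI := isMarkovKernel_heatBathSweep (μ := μ) hp hm0 hMtop hmp hpM l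
  haveI := isProbabilityMeasure_piGibbsLaw (μ := μ) (p := p) hm0 hMtop hmp hpM
  haveI : IsProbabilityMeasure ((Measure.pi μ).bind η) :=
    ⟨by rw [Measure.bind_apply MeasurableSet.univ (Kernel.aemeasurable _)]; simp⟩
  have hmin := fun a =>
    minorised_comp_left (heatBathSweep_minorised (μ := μ) hp hm0 hMtop hmp hpM hl) η a
  have hinv : Kernel.Invariant (η ∘ₖ cycle (l.map (siteHeatBath μ p))) (piGibbsLaw μ p) :=
    (invariant_smul hη _).comp (heatBathSweep_invariant_piGibbsLaw (μ := μ) hp hm0 hMtop hmp hpM l)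
  have h := uniformlyErgodic_of_minorised hmin hinv μ₀ t A
  rwa [ENNReal.toReal_pow, ENNReal.toReal_mul, ENNReal.toReal_inv, ← div_eq_mul_inv] at h

end Bounded

end Summit.Ventures.LatticeQCDFlow.Exactness
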